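import Summits.CriticalPhenomena.PercolationContinuityZ3.Theorems.Transplant.PlanarSkeletonFrmScaledCoarseCyl
import Summits.CriticalPhenomena.PercolationContinuityZ3.Theorems.Transplant.PlanarSkeletonFrmScaledCoarseProxy
import HarnessLib

/-!
# The coarse chart of a SCALED skeleton with ANY NUMBER OF TYPES: coarse cylinders connected at every vertex, residue types with exact coarse frames
# (no one-type hypothesis), and BASE-TYPE PROXIES under CHART-ALIGNMENT of the types (the multi-type port of dictionary parts 2–4)

builds on p205010 (kernel theorem, internal audit signed; external expert review pending) — nothing in this file uses p205010, and NOTHING is claimed about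
any open node or about Conj. 4 in general: no node, no statement, no `@[conjecture]` is declared or edited here.  Lane `prim-bschramm`, seat
`prim-bschramm-gen-1` g3 (GEN pen, p3-lineage brief; the design owner's NEXT-SCOPE (N1), p3-g27 2026-08-27); helper file
(`--supports stmt-CriticalPhenomena-4575 --as helper`); PROOFS ONLY, def-free (everything packaged existentially, as parts 1 and 4).

WHAT IT RECORDS.  Parts 1–5 of the coarse-chart dictionary («PlanarSkeletonFrmScaledCoarse/…Cyl/…Subcrit/…Proxy/…FrmFrom», p3-g25/g26) are stated for a
ONE-TYPE scaled skeleton (`h1 : Φ.types = {t}`); the one-type hypothesis is consumed only through `exists_fineFrame h1 u v` (any two vertices are exchanged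
by a fine-chart-translating automorphism).  For a `PlanarSkeletonFrmScaled` with ANY number of types that lemma survives for two vertices framed from the SAME
fine type (§1), which is all that parts 2–3 need; the proxies of part 4 need in addition that the translation vectors of the chart-translating automorphisms
reach every type — CHART-ALIGNMENT.  Let `Φ : PlanarSkeletonFrmScaled G` (`L`-Lipschitz chart `φ`, translating frames over `Φ.types`, exact single-edge `N`-steps,
cylinders connected from `ℓ₀` on) and `Φ.coarse = ⌊φ/N⌋`.
* §1 `exists_fineFrame_of_frames`: two vertices framed from the same base vertex are exchanged by an automorphism translating the fine chart by their chart
  difference; translations compose (`frame_trans`) and invert (`frame_symm`).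
* §2 `induce_fineCyl_connected'` / **`coarse_cyl_connected'`**: fine cylinders from half-width `ℓ₀` and COARSE cylinders from half-width `max ℓ₀ 1` are
  connected AT EVERY VERTEX (part 2's `N`-step descent, the fine frame of the centre taken from its own type); `coarse_cylConnFrom' T` for every finite `T`.
* §3 **`exists_coarseTypesAt t`** (any vertex `t`): a finite set `T ∋ t` of at most `|Φ.types| · N²` vertices (one per fine type and residue of `φ − φ(type) (mod N)`
  that occurs) with `Skelφ.Frames G Φ.coarse T` — every vertex is the image of a member of `T` under an automorphism translating the COARSE chart EXACTLY.
  So for `L ≤ N` the coarse chart of EVERY scaled skeleton is a multi-type `PlanarSkeletonFrmFrom` datum (`coarse_lip`, `steps_coarse`, §2, §3) — no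
  one-type hypothesis anywhere.
* §4 CHART-ALIGNMENT AND PROXIES.  Call the types ALIGNED with a vertex `t` when `∀ s ∈ Φ.types, ∃ α : G ≃g G, φ ∘ α = φ + (φ s − φ t)` (the hypothesis is
  spelled out, no definition).  Then every vertex `c` has `φ c − φ t` among the translation vectors (`exists_translate_sub_of_aligned`), so do all of `N ℤ²`
  (`exists_translate_Nvec_of_aligned`), and **`exists_proxies_of_aligned`**: on a connected graph there is ONE radius `D` such that every vertex `c` has a
  PROXY `c′` framed from `t` by an automorphism translating `φ` by the `N`-DIVISIBLE vector `φ c′ − φ t` (hence translating `⌊φ/N⌋` exactly), in the SAME coarse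
  cell as `c`, within graph distance `D` of `c` both ways — part 4's conclusion verbatim, with `h1` replaced by alignment (one type: `α := 1`,
  `aligned_of_types_eq`; pairwise-aligned types are aligned with every vertex, `aligned_of_pairwise`).
With «SkelFrmFromProxHoldsAll» p486426 (`θ_t(p_c) = 0` for every multi-type `PlanarSkeletonFrmFrom` at a type with proxies) this is every input of the
aligned multi-type scaled closure; that composition is a separate file.  Existing parts 1–5 are untouched (their one-type statements remain the U_s node's inputs).
[cite: KozmaNitzan2024, §4 p. 15 (boxes and their translates), p. 16 (Lemma 8: the role of the lattice symmetries), pp. 19–21 ((21)–(25))]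
[cite: BenjaminiSchramm1996, Conj. 4; §2] [cite: MartineauTassion2017, §3.2] [this work]
-/

noncomputable section

namespace Summit.CriticalPhenomena.PercolationContinuityZ3.Theorems.Transplant

open Literature.Probability.LatticeModels SimpleGraph
open Literature.Probability.Percolation.GrimmettMarstrand1990 (induceIso)
open Literature.Barriers.CriticalPhenomena (graphBall mem_graphBall_self graphBall_mono mem_graphBall_map)
open scoped Classical

namespace PlanarSkeletonFrmScaled

variable {V : Type} {G : SimpleGraph V} [G.LocallyFinite] (Φ : PlanarSkeletonFrmScaled G)

/-! ## §1 Fine frames between vertices framed from the same type; composing and inverting chart translations -/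

/-- **Chart translations invert**: an automorphism translating the fine chart by `c` has inverse translating it by `−c`. [folklore] -/
theorem frame_symm {α : G ≃g G} {c : Site 2} (hα : ∀ w, Φ.φ (α w) = Φ.φ w + c) (w : V) : Φ.φ (α.symm w) = Φ.φ w + -c := by
  have h := hα (α.symm w)
  rw [RelIso.apply_symm_apply] at h
  rw [h, add_neg_cancel_right]

/-- **Chart translations compose**: automorphisms translating the fine chart by `c` and `d` compose to one translating it by `c + d`. [folklore] -/
theorem frame_trans {α β : G ≃g G} {c d : Site 2} (hα : ∀ w, Φ.φ (α w) = Φ.φ w + c) (hβ : ∀ w, Φ.φ (β w) = Φ.φ w + d) (w : V) :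
    Φ.φ ((α.trans β) w) = Φ.φ w + (c + d) := by
  show Φ.φ (β (α w)) = Φ.φ w + (c + d)
  rw [hβ, hα, add_assoc]

/-- **Homogeneity inside one fine type**: two vertices `u = γ s`, `v = α s` framed from the SAME base vertex `s` are exchanged by the automorphism `α ∘ γ⁻¹`,
which translates the fine chart by `φ v − φ u` (the multi-type form of part 1's `exists_fineFrame`). [cite: KozmaNitzan2024, §4 p. 15 (boxes and their translates)] -/
theorem exists_fineFrame_of_frames {s u v : V} {γ α : G ≃g G} (hγ : γ s = u) (hγφ : ∀ w, Φ.φ (γ w) = Φ.φ w + (Φ.φ u - Φ.φ s))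
    (hα : α s = v) (hαφ : ∀ w, Φ.φ (α w) = Φ.φ w + (Φ.φ v - Φ.φ s)) :
    ∃ β : G ≃g G, β u = v ∧ ∀ w, Φ.φ (β w) = Φ.φ w + (Φ.φ v - Φ.φ u) := by
  refine ⟨γ.symm.trans α, ?_, fun w => ?_⟩
  · show α (γ.symm u) = v
    rw [← hγ, γ.symm_apply_apply, hα]
  · rw [Φ.frame_trans (Φ.frame_symm hγφ) hαφ w]
    abel

/-! ## §2 Fine and coarse cylinders at every vertex are connected (any number of types) -/

/-- **Fine cylinders at EVERY vertex of a scaled skeleton are connected from half-width `ℓ₀` on** — any number of types: the field (κ′) at the type `s` of `v`,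
transported along the frame `s ↦ v`. [cite: KozmaNitzan2024, §4 p. 15 (boxes and their translates)] -/
theorem induce_fineCyl_connected' (v : V) {ℓ : ℕ} (hℓ : Φ.ℓ₀ ≤ ℓ) : (G.induce (Skelφ.cyl Φ.φ v ℓ)).Connected := by
  obtain ⟨s, hs, β, hβs, hβ⟩ := Φ.frame v
  have hc := Φ.cyl_connected s hs ℓ hℓ
  have e : G.induce {w | Φ.φ w - Φ.φ s ∈ box 2 ℓ} ≃g G.induce (Skelφ.cyl Φ.φ v ℓ) :=
    induceIso β fun w => by
      rw [Set.mem_setOf_eq, Skelφ.mem_cyl, hβ w]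
      have e : Φ.φ w + (Φ.φ v - Φ.φ s) - Φ.φ v = Φ.φ w - Φ.φ s := by abel
      rw [e]
  exact e.connected_iff.1 hc

/-- **COARSE CYLINDERS ARE CONNECTED at every vertex, half-width `ℓ ≥ max ℓ₀ 1`** — any number of types (part 2's `coarse_cyl_connected` with the fine cylinder of the
centre connected by `induce_fineCyl_connected'`): every `w ∈ C = cyl ⌊φ/N⌋ v ℓ` descends inside `C` by exact `N`-steps (`reach_near`) to the fine cylinder
`cyl φ v (max ℓ₀ N) ⊆ C`. [cite: KozmaNitzan2024, §4 p. 15 (boxes and their translates), p. 16 (Lemma 8)] -/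
theorem coarse_cyl_connected' (v : V) {ℓ : ℕ} (hℓ : max Φ.ℓ₀ 1 ≤ ℓ) : (G.induce (Skelφ.cyl Φ.coarse v ℓ)).Connected := by
  have hℓ1 : 1 ≤ ℓ := le_trans (le_max_right _ _) hℓ
  have hℓ0 : Φ.ℓ₀ ≤ ℓ := le_trans (le_max_left _ _) hℓ
  set C := Skelφ.cyl Φ.coarse v ℓ with hC
  set m : ℕ := max Φ.ℓ₀ Φ.N with hm
  have hmconn : (G.induce (Skelφ.cyl Φ.φ v m)).Connected := Φ.induce_fineCyl_connected' v (le_max_left _ _)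
  have hmN : m ≤ Φ.N * ℓ := by
    refine max_le ?_ ?_
    · exact hℓ0.trans (Nat.le_mul_of_pos_left ℓ Φ.one_le_N)
    · exact Nat.le_mul_of_pos_right _ hℓ1
  have hsub : Skelφ.cyl Φ.φ v m ⊆ C := (Skelφ.cyl_mono Φ.φ v hmN).trans (Φ.cyl_fine_subset_coarse v ℓ)
  have hvC : v ∈ C := Skelφ.self_mem_cyl Φ.coarse v ℓ
  have key : ∀ x : C, (G.induce C).Reachable ⟨v, hvC⟩ x := by
    rintro ⟨w, hw⟩
    obtain ⟨w', hw', hr, hnear⟩ := Φ.reach_near hℓ1 hw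
    have hw'm : w' ∈ Skelφ.cyl Φ.φ v m := Skelφ.cyl_mono Φ.φ v (by omega) hnear
    have hvm : v ∈ Skelφ.cyl Φ.φ v m := Skelφ.self_mem_cyl Φ.φ v m
    obtain ⟨W⟩ := hmconn.preconnected ⟨v, hvm⟩ ⟨w', hw'm⟩
    obtain ⟨W', -⟩ := Skel.exists_walk_induce_mono (G := G) hsub W
    exact (W'.reachable).trans hr.symm
  haveI : Nonempty C := ⟨⟨v, hvC⟩⟩
  exact ⟨fun x y => (key x).symm.trans (key y)⟩

/-- **(κ′) FOR THE COARSE CHART over EVERY finite set of base vertices**, any number of types: `Skelφ.CylConnFrom G ⌊φ/N⌋ T (max ℓ₀ 1)`.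
[cite: KozmaNitzan2024, §4 p. 15 (boxes and their translates)] -/
theorem coarse_cylConnFrom' (T : Finset V) : Skelφ.CylConnFrom G Φ.coarse T (max Φ.ℓ₀ 1) :=
  fun v _ _ hℓ => Φ.coarse_cyl_connected' v hℓ

/-! ## §3 Coarse types with exact coarse frames, for any number of fine types -/

/-- **THE COARSE TYPES, any number of fine types (existential packaging, def-free).**  For every vertex `t` there is a finite set `T ∋ t` of at most `|Φ.types| · N²`
vertices — one per pair (fine type `s`, residue of `φ − φ s (mod N)`) that occurs, `t` representing its own pair — with **`Skelφ.Frames G Φ.coarse T`**: every vertex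
`v`, framed from the fine type `s`, is the image of the representative `t'` of its pair under the automorphism `t' ↦ s ↦ v` of §1, whose fine translation
`φ v − φ t'` is `N`-divisible and therefore translates the COARSE chart EXACTLY (part 1's `coarse_translate_of_dvd`).  No one-type hypothesis.
[cite: KozmaNitzan2024, §4 p. 16 (Lemma 8: the role of the lattice symmetries)] -/
theorem exists_coarseTypesAt (t : V) :
    ∃ T : Finset V, t ∈ T ∧ T.card ≤ Φ.types.card * Φ.N ^ 2 ∧ Skelφ.Frames G Φ.coarse T := by
  have hN := Φ.N_pos
  -- a chosen fine frame for every vertex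
  have hfr := Φ.frame
  choose sOf hsOf αOf hαOf hφOf using hfr
  -- the pair (fine type, residue of the fine translation modulo `N`) of a vertex; one representative per pair, `t` representing its own
  let res : V → (Fin 2 → ℤ) := fun v i => (Φ.φ v i - Φ.φ (sOf v) i) % (Φ.N : ℤ)
  let key : V → V × (Fin 2 → ℤ) := fun v => (sOf v, res v)
  let rep : V × (Fin 2 → ℤ) → V := fun k => if k = key t then t else if h : ∃ v, key v = k then h.choose else t
  let R : Finset (Fin 2 → ℤ) := Fintype.piFinset fun _ : Fin 2 => Finset.Ico (0 : ℤ) Φ.N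
  have hkey_mem : ∀ v, key v ∈ Φ.types ×ˢ R := fun v => by
    rw [Finset.mem_product]
    refine ⟨hsOf v, ?_⟩
    rw [Fintype.mem_piFinset]
    intro i
    rw [Finset.mem_Ico]
    exact ⟨Int.emod_nonneg _ hN.ne', Int.emod_lt_of_pos _ hN⟩
  have hrep_t : rep (key t) = t := by simp [rep]
  have hrep : ∀ v, key (rep (key v)) = key v := fun v => by
    by_cases hv : key v = key t
    · rw [hv, hrep_t]
    · have h : ∃ v', key v' = key v := ⟨v, rfl⟩
      simp only [rep, if_neg hv, dif_pos h]
      exact h.choose_spec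
  have hcardR : R.card = Φ.N ^ 2 := by
    rw [Fintype.card_piFinset, Finset.prod_const, Finset.card_univ, Fintype.card_fin, Int.card_Ico, sub_zero, Int.toNat_natCast]
  refine ⟨(Φ.types ×ˢ R).image rep, ?_, ?_, fun v => ?_⟩
  · rw [← hrep_t]; exact Finset.mem_image_of_mem rep (hkey_mem t)
  · refine (Finset.card_image_le).trans ?_
    rw [Finset.card_product, hcardR]
  · -- the coarse frame of `v` from the representative `t'` of its pair: same fine type `s`, same residue, so `φ v − φ t'` is `N`-divisible
    set t' : V := rep (key v) with ht'
    have hk : key t' = key v := by rw [ht', hrep v]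
    have hs : sOf t' = sOf v := congrArg Prod.fst hk
    have hr : res t' = res v := congrArg Prod.snd hk
    have hγ : αOf t' (sOf v) = t' := by rw [← hs]; exact hαOf t'
    have hγφ : ∀ w, Φ.φ (αOf t' w) = Φ.φ w + (Φ.φ t' - Φ.φ (sOf v)) := by rw [← hs]; exact hφOf t'
    obtain ⟨β, hβt, hβ⟩ := Φ.exists_fineFrame_of_frames hγ hγφ (hαOf v) (hφOf v)
    have hdvd : ∀ i, (Φ.N : ℤ) ∣ (Φ.φ v - Φ.φ t') i := by
      intro i
      have h : res t' i = res v i := by rw [hr]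
      have hmod : Int.ModEq (Φ.N : ℤ) (Φ.φ t' i - Φ.φ (sOf v) i) (Φ.φ v i - Φ.φ (sOf v) i) := by
        have h' : (Φ.φ t' i - Φ.φ (sOf t') i) % (Φ.N : ℤ) = (Φ.φ v i - Φ.φ (sOf v) i) % (Φ.N : ℤ) := h
        rw [hs] at h'
        exact h'
      have := hmod.dvd
      rwa [sub_sub_sub_cancel_right] at this
    refine ⟨t', Finset.mem_image_of_mem rep (hkey_mem v), β, hβt, fun w => ?_⟩
    rw [Φ.coarse_translate_of_dvd hβ hdvd w]
    congr 1
    funext i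
    obtain ⟨d, hd⟩ := hdvd i
    rw [Pi.sub_apply] at hd
    have hv : Φ.φ v i = Φ.φ t' i + d * (Φ.N : ℤ) := by linarith
    rw [Pi.sub_apply, Pi.sub_apply, hd, Int.mul_ediv_cancel_left _ hN.ne', coarse_apply, coarse_apply, hv, Int.add_mul_ediv_right _ _ hN.ne']
    ring

/-! ## §4 Chart-aligned types: every chart difference is a translation vector; base-type proxies -/

/-- **One type is aligned** with its base vertex (take `α := 1`). [folklore] -/
theorem aligned_of_types_eq {t : V} (h1 : Φ.types = {t}) :
    ∀ s ∈ Φ.types, ∃ α : G ≃g G, ∀ w, Φ.φ (α w) = Φ.φ w + (Φ.φ s - Φ.φ t) := by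
  intro s hs
  rw [h1, Finset.mem_singleton] at hs
  subst hs
  exact ⟨RelIso.refl _, fun w => by rw [sub_self, add_zero]; rfl⟩

/-- **Pairwise-aligned types are aligned with EVERY vertex** (compose with the inverse frame of the vertex). [folklore] -/
theorem aligned_of_pairwise (hal : ∀ s ∈ Φ.types, ∀ s' ∈ Φ.types, ∃ α : G ≃g G, ∀ w, Φ.φ (α w) = Φ.φ w + (Φ.φ s - Φ.φ s')) (t : V) :
    ∀ s ∈ Φ.types, ∃ α : G ≃g G, ∀ w, Φ.φ (α w) = Φ.φ w + (Φ.φ s - Φ.φ t) := by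
  intro s hs
  obtain ⟨s₀, hs₀, α₀, -, hα₀⟩ := Φ.frame t
  obtain ⟨α₁, hα₁⟩ := hal s hs s₀ hs₀
  refine ⟨α₀.symm.trans α₁, fun w => ?_⟩
  rw [Φ.frame_trans (Φ.frame_symm hα₀) hα₁ w]
  abel

/-- **Under alignment every chart difference `φ c − φ t` is a translation vector** (compose the frame `s ↦ c` of `c` with the aligning automorphism of its type `s`).
[this work] -/
theorem exists_translate_sub_of_aligned {t : V} (hal : ∀ s ∈ Φ.types, ∃ α : G ≃g G, ∀ w, Φ.φ (α w) = Φ.φ w + (Φ.φ s - Φ.φ t)) (c : V) :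
    ∃ α : G ≃g G, ∀ w, Φ.φ (α w) = Φ.φ w + (Φ.φ c - Φ.φ t) := by
  obtain ⟨s, hs, αc, -, hαc⟩ := Φ.frame c
  obtain ⟨β, hβ⟩ := hal s hs
  refine ⟨β.trans αc, fun w => ?_⟩
  rw [Φ.frame_trans hβ hαc w]
  abel

/-- **Under alignment every vector of `N ℤ²` is a translation vector** (the vertex `N`-steps away from `t` over `φ t + N z`, §2 of part 4, and the previous lemma).
[this work] -/
theorem exists_translate_Nvec_of_aligned {t : V} (hal : ∀ s ∈ Φ.types, ∃ α : G ≃g G, ∀ w, Φ.φ (α w) = Φ.φ w + (Φ.φ s - Φ.φ t)) (z : Site 2) :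
    ∃ α : G ≃g G, ∀ w, Φ.φ (α w) = Φ.φ w + fun i => (Φ.N : ℤ) * z i := by
  obtain ⟨w₀, hw₀⟩ := Φ.exists_φ_eq_add_Nvec t z
  obtain ⟨α, hα⟩ := Φ.exists_translate_sub_of_aligned hal w₀
  exact ⟨α, fun w => by rw [hα w, hw₀, add_sub_cancel_left]⟩

/-- **BASE-TYPE PROXIES UNDER ALIGNMENT — any number of types.**  On a connected graph carrying a scaled skeleton whose types are aligned with the vertex `t`
there is a radius `D` such that EVERY vertex `c` has a PROXY `c′` with a frame `α : t ↦ c′` translating `φ` by the `N`-DIVISIBLE vector `φ c′ − φ t` — hence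
translating the coarse chart `⌊φ/N⌋` EXACTLY by `⌊φ c′/N⌋ − ⌊φ t/N⌋` —, lying in the SAME coarse cell as `c`, and within graph distance `D` of `c` (both ways).
Construction (part 4's, per fine type): `c′ := α_c u` for the frame `α_c : s ↦ c` of `c` from its type `s` and a realiser `u`, framed from `t`, of the target
value `φ s + proxyVec t c` — it exists because `φ s + proxyVec t c − φ t = (φ c + proxyVec t c − φ t) − (φ c − φ s) ∈ N ℤ² + (translations)` is a translation vector
under alignment; one realiser per (type, offset) in the finite box gives the uniform radius. [cite: KozmaNitzan2024, §4 p. 15, pp. 19–21 ((21)–(25))] [this work] -/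
theorem exists_proxies_of_aligned (hc : G.Connected) (t : V)
    (hal : ∀ s ∈ Φ.types, ∃ α : G ≃g G, ∀ w, Φ.φ (α w) = Φ.φ w + (Φ.φ s - Φ.φ t)) :
    ∃ D : ℕ, ∀ c : V, ∃ (c' : V) (α : G ≃g G), α t = c' ∧ (∀ w, Φ.φ (α w) = Φ.φ w + (Φ.φ c' - Φ.φ t)) ∧
      (∀ i, (Φ.N : ℤ) ∣ (Φ.φ c' - Φ.φ t) i) ∧ (∀ w, Φ.coarse (α w) = Φ.coarse w + (Φ.coarse c' - Φ.coarse t)) ∧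
      Φ.coarse c' = Φ.coarse c ∧ c ∈ graphBall G c' D ∧ c' ∈ graphBall G c D := by
  have hN := Φ.N_pos
  -- one realiser, framed from `t`, per (fine type, offset) pair that occurs, with a walk from the type
  have hreal : ∀ sd : V × Site 2, ∃ (u : V) (n : ℕ),
      ((∃ c : V, (∃ α : G ≃g G, α sd.1 = c ∧ ∀ w, Φ.φ (α w) = Φ.φ w + (Φ.φ c - Φ.φ sd.1)) ∧ Φ.proxyVec t c = sd.2) →
        (∃ γ : G ≃g G, γ t = u ∧ ∀ w, Φ.φ (γ w) = Φ.φ w + (Φ.φ u - Φ.φ t)) ∧ Φ.φ u = Φ.φ sd.1 + sd.2) ∧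
      u ∈ graphBall G sd.1 n := by
    rintro ⟨s, d⟩
    by_cases hsd : ∃ c : V, (∃ α : G ≃g G, α s = c ∧ ∀ w, Φ.φ (α w) = Φ.φ w + (Φ.φ c - Φ.φ s)) ∧ Φ.proxyVec t c = d
    · obtain ⟨c, ⟨αc, -, hαc⟩, hcd⟩ := hsd
      -- `φ c + d − φ t ∈ N ℤ²`
      have hq : ∀ i, ∃ q : ℤ, (Φ.φ c i - Φ.φ t i) + d i = (Φ.N : ℤ) * q := fun i => by
        rw [← hcd]; exact dvd_proxyOff (Φ.N : ℤ) (Φ.φ c i) (Φ.φ t i)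
      choose q hq using hq
      obtain ⟨αN, hαN⟩ := Φ.exists_translate_Nvec_of_aligned hal q
      -- the realiser `u := (αN ∘ αc⁻¹) t`: translation `N q − (φ c − φ s) = φ s + d − φ t`
      have hγ : ∀ w, Φ.φ ((αc.symm.trans αN) w) = Φ.φ w + (Φ.φ s + d - Φ.φ t) := by
        intro w
        rw [Φ.frame_trans (Φ.frame_symm hαc) hαN w]
        congr 1
        funext i
        simp only [Pi.add_apply, Pi.sub_apply, Pi.neg_apply]
        have := hq i
        linarith
      obtain ⟨W⟩ := hc.preconnected s ((αc.symm.trans αN) t)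
      refine ⟨(αc.symm.trans αN) t, W.length, fun _ => ⟨⟨αc.symm.trans αN, rfl, fun w => ?_⟩, ?_⟩, ⟨W, le_rfl⟩⟩
      · rw [hγ w, hγ t]; abel
      · rw [hγ t]; abel
    · exact ⟨s, 0, fun h => absurd h hsd, mem_graphBall_self G s 0⟩
  choose u n hu hun using hreal
  -- the radius: the largest walk length over the finite set (types) × (box of offsets)
  set B : Finset (Site 2) := Fintype.piFinset fun _ : Fin 2 => Finset.Icc (-(Φ.N : ℤ)) Φ.N with hB
  have hmemB : ∀ c, Φ.proxyVec t c ∈ B := fun c => by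
    rw [hB, Fintype.mem_piFinset]
    intro i
    rw [Finset.mem_Icc]
    exact (mem_box.1 (Φ.proxyVec_mem_box t c)) i
  refine ⟨(Φ.types ×ˢ B).sup n, fun c => ?_⟩
  -- the fine frame `s ↦ c` of `c` from its type and the proxy `c′ := α_c (u (s, d))`
  obtain ⟨s, hs, αc, hαcs, hαc⟩ := Φ.frame c
  set d := Φ.proxyVec t c with hd
  have hsdmem : (s, d) ∈ Φ.types ×ˢ B := Finset.mem_product.2 ⟨hs, hmemB c⟩
  obtain ⟨⟨γ, hγt, hγ⟩, hφu⟩ := hu (s, d) ⟨c, ⟨αc, hαcs, hαc⟩, rfl⟩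
  set c' : V := αc (u (s, d)) with hc'
  have hφc' : Φ.φ c' = Φ.φ c + d := by
    rw [hc', hαc (u (s, d)), hφu]; abel
  -- (p1) `N`-divisibility of `φ c′ − φ t`
  have hdvd : ∀ i, (Φ.N : ℤ) ∣ (Φ.φ c' - Φ.φ t) i := by
    intro i
    rw [Pi.sub_apply, hφc', Pi.add_apply]
    have := dvd_proxyOff (Φ.N : ℤ) (Φ.φ c i) (Φ.φ t i)
    have e : Φ.φ c i + d i - Φ.φ t i = Φ.φ c i - Φ.φ t i + proxyOff (Φ.N : ℤ) (Φ.φ c i) (Φ.φ t i) := by rw [hd]; unfold proxyVec; ring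
    rw [e]; exact this
  -- the frame `t ↦ c′`: `α_c ∘ γ`
  have hα : ∀ w, Φ.φ ((γ.trans αc) w) = Φ.φ w + (Φ.φ c' - Φ.φ t) := by
    intro w
    rw [Φ.frame_trans hγ hαc w, hφc', hφu]
    abel
  have hαt : (γ.trans αc) t = c' := by
    show αc (γ t) = c'
    rw [hγt]
  -- (p2) same coarse cell
  have hcell : Φ.coarse c' = Φ.coarse c := by
    funext i
    rw [coarse_apply, coarse_apply, hφc', Pi.add_apply, hd]
    exact ediv_add_proxyOff hN (Φ.φ c i) (Φ.φ t i)
  -- exact coarse translation by the frame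
  have hcoarse : ∀ w, Φ.coarse ((γ.trans αc) w) = Φ.coarse w + (Φ.coarse c' - Φ.coarse t) := by
    intro w
    rw [Φ.coarse_translate_of_dvd hα hdvd w]
    congr 1
    funext i
    obtain ⟨q, hq⟩ := hdvd i
    rw [Pi.sub_apply] at hq
    have hv : Φ.φ c' i = Φ.φ t i + q * (Φ.N : ℤ) := by linarith
    rw [Pi.sub_apply, Pi.sub_apply, hq, Int.mul_ediv_cancel_left _ hN.ne', coarse_apply, coarse_apply, hv, Int.add_mul_ediv_right _ _ hN.ne']
    ring
  -- (p3) graph distance both ways: `c′ = α_c (u (s,d))`, `c = α_c s`, and `u (s,d) ∈ graphBall s (n (s,d))`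
  have hnD : n (s, d) ≤ (Φ.types ×ˢ B).sup n := Finset.le_sup (f := n) hsdmem
  have hcc' : c' ∈ graphBall G c ((Φ.types ×ˢ B).sup n) := by
    have h := mem_graphBall_map αc (hun (s, d))
    rw [hαcs] at h
    exact graphBall_mono G c hnD h
  have hc'c : c ∈ graphBall G c' ((Φ.types ×ˢ B).sup n) := by
    obtain ⟨w', hw'⟩ := hcc'
    exact ⟨w'.reverse, by rw [SimpleGraph.Walk.length_reverse]; exact hw'⟩
  exact ⟨c', γ.trans αc, hαt, hα, hdvd, hcoarse, hcell, hc'c, hcc'⟩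

end PlanarSkeletonFrmScaled

end Summit.CriticalPhenomena.PercolationContinuityZ3.Theorems.Transplant

end
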